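import Summits.ValiantsHypothesis.ValiantsHypothesis.Theorems.GeneratorObstructionsPerGenDegreeSuperQPSingerDesigns

/-!
# Route GeneratorObstructions — K1 `PerGenDegreeSuperQP` (stmt-ValiantsHypothesis-11654),
# line `per-side-atoms`: SMALL DESIGNS — the chamber-ray tables of `S(per_3)` and `S(per_4)`

Explicit additive designs (`…CollapseDesigns`, `per_ray_hit_of_additive_design`) found by an exact
rational LP over the couplings (this session, `calc/lp_designs.py` in the hand's folder; pure
occupancy certificates, each a positive doubly stochastic `m × m` matrix with flat label profile):

* `per_three_ray_five_hit` — ray `5` of `S(per_3)` (Hankel design mod 5);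
* `per_four_ray_seven_hit`, `…nine…`, `…ten…`, `…eleven…`, `…twelve…` — rays `7, 9, 10, 11, 12`
  of `S(per_4)`.

Resulting CHAMBER-RAY TABLES (with `…ModularCollapseRays` `j ≤ m`, the divisor families
`r₁r₂`, `r + p`, and `…SingerDesigns`):
* `S(per_3)`: rays `1, 2, 3, 4, 5, 6, 7, 9` are hit; ray `8` is OPEN (no labelled design exists for
  `j = m² - 1`; occupancy by a genuinely linear substitution is not excluded).
* `S(per_4)`: rays `1, …, 13` and `16` are hit; rays `14, 15` are OPEN (exact LP: no additive design
  with `a = id`; `15 = m² - 1` has no labelled design at all).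
First-occurrence DEGREES on all these rays — the registered content of `stub_atomLate` — are
untouched. Honest framing: calibration certificates; `stub_atomLate` (`c ≥ 2`), K1 and
`GenFlipThesis` remain OPEN; nothing here bears on VP versus VNP.
References: [BurgisserIkenmeyer2017] Prop. 2.8 (corrected), Def. 3.3. [folklore]
-/

set_option linter.dupNamespace false

noncomputable section

namespace Summit.ValiantsHypothesis.ValiantsHypothesis.Theorems.GeneratorObstructions.PerGenDegreeSuperQP

open MvPolynomial
open Literature.NumberTheory.DiophantineGeometry Literature.Computability.AlgebraicComplexity
  Literature.Computability.Complexity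

/-- **Ray 5 of `S(per_3)` is hit** — Hankel design `ℓ(i',i) = (i' + i) mod 5`, coupling found by exact LP (new: `5` is neither a product nor a sum of two divisors of `3`). [folklore] -/
theorem per_three_ray_five_hit :
    ∃ k : ℕ, 0 < k ∧
      highestWeightSpace (orbitCoordRep (MvPolynomial.rename toLex (perPoly (Fin 3) ℂ)) 3)
        (partitionWeightLex 3 (Nat.Partition.rectangle 5 k)) ≠ ⊥ := by
  refine per_ray_hit_of_additive_design (m := 3) (j := 5) (by norm_num)
    (![0, 1, 2] : Fin 3 → Fin 5) (![0, 1, 2] : Fin 3 → Fin 5)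
    (!![(3/5 : ℚ), 3/10, 1/10; 3/10, 2/5, 3/10; 1/10, 3/10, 3/5] : Matrix (Fin 3) (Fin 3) ℚ) ?_ ?_ ?_ ((3 : ℚ) / 5) (by norm_num) ?_
  · intro i i'
    fin_cases i <;> fin_cases i' <;> simp
  · intro i
    fin_cases i <;> simp [Fin.sum_univ_succ] <;> norm_num
  · intro i'
    fin_cases i' <;> simp [Fin.sum_univ_succ] <;> norm_num
  · intro y
    fin_cases y <;> simp [Fin.sum_univ_succ] <;> norm_num

/-- **Ray 7 of `S(per_4)` is hit** — Hankel design `ℓ(i',i) = (i' + i) mod 7` (new). [folklore] -/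
theorem per_four_ray_seven_hit :
    ∃ k : ℕ, 0 < k ∧
      highestWeightSpace (orbitCoordRep (MvPolynomial.rename toLex (perPoly (Fin 4) ℂ)) 4)
        (partitionWeightLex 4 (Nat.Partition.rectangle 7 k)) ≠ ⊥ := by
  refine per_ray_hit_of_additive_design (m := 4) (j := 7) (by norm_num)
    (![0, 1, 2, 3] : Fin 4 → Fin 7) (![0, 1, 2, 3] : Fin 4 → Fin 7)
    (!![(4/7 : ℚ), 2/7, 1/14, 1/14; 2/7, 3/7, 3/14, 1/14; 1/14, 3/14, 3/7, 2/7; 1/14, 1/14, 2/7, 4/7] : Matrix (Fin 4) (Fin 4) ℚ) ?_ ?_ ?_ ((4 : ℚ) / 7) (by norm_num) ?_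
  · intro i i'
    fin_cases i <;> fin_cases i' <;> simp
  · intro i
    fin_cases i <;> simp [Fin.sum_univ_succ] <;> norm_num
  · intro i'
    fin_cases i' <;> simp [Fin.sum_univ_succ] <;> norm_num
  · intro y
    fin_cases y <;> simp [Fin.sum_univ_succ] <;> norm_num

/-- **Ray 9 of `S(per_4)` is hit** — design `ℓ(i',i) = (i' + 2i) mod 9` (new). [folklore] -/
theorem per_four_ray_nine_hit :
    ∃ k : ℕ, 0 < k ∧
      highestWeightSpace (orbitCoordRep (MvPolynomial.rename toLex (perPoly (Fin 4) ℂ)) 4)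
        (partitionWeightLex 4 (Nat.Partition.rectangle 9 k)) ≠ ⊥ := by
  refine per_ray_hit_of_additive_design (m := 4) (j := 9) (by norm_num)
    (![0, 1, 2, 3] : Fin 4 → Fin 9) (![0, 2, 4, 6] : Fin 4 → Fin 9)
    (!![(2/9 : ℚ), 4/9, 4/27, 5/27; 8/27, 7/27, 4/27, 8/27; 8/27, 4/27, 7/27, 8/27; 5/27, 4/27, 4/9, 2/9] : Matrix (Fin 4) (Fin 4) ℚ) ?_ ?_ ?_ ((4 : ℚ) / 9) (by norm_num) ?_
  · intro i i'
    fin_cases i <;> fin_cases i' <;> simp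
  · intro i
    fin_cases i <;> simp [Fin.sum_univ_succ] <;> norm_num
  · intro i'
    fin_cases i' <;> simp [Fin.sum_univ_succ] <;> norm_num
  · intro y
    fin_cases y <;> simp [Fin.sum_univ_succ] <;> norm_num

/-- **Ray 10 of `S(per_4)` is hit** — design `ℓ(i',i) = (i' + 2i) mod 10` (new). [folklore] -/
theorem per_four_ray_ten_hit :
    ∃ k : ℕ, 0 < k ∧
      highestWeightSpace (orbitCoordRep (MvPolynomial.rename toLex (perPoly (Fin 4) ℂ)) 4)
        (partitionWeightLex 4 (Nat.Partition.rectangle 10 k)) ≠ ⊥ := by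
  refine per_ray_hit_of_additive_design (m := 4) (j := 10) (by norm_num)
    (![0, 1, 2, 3] : Fin 4 → Fin 10) (![0, 2, 4, 6] : Fin 4 → Fin 10)
    (!![(2/5 : ℚ), 2/5, 1/10, 1/10; 3/10, 3/10, 1/5, 1/5; 1/5, 1/5, 3/10, 3/10; 1/10, 1/10, 2/5, 2/5] : Matrix (Fin 4) (Fin 4) ℚ) ?_ ?_ ?_ ((4 : ℚ) / 10) (by norm_num) ?_
  · intro i i'
    fin_cases i <;> fin_cases i' <;> simp
  · intro i
    fin_cases i <;> simp [Fin.sum_univ_succ] <;> norm_num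
  · intro i'
    fin_cases i' <;> simp [Fin.sum_univ_succ] <;> norm_num
  · intro y
    fin_cases y <;> simp [Fin.sum_univ_succ] <;> norm_num

/-- **Ray 11 of `S(per_4)` is hit** — design `a = (0,1,2,3)`, `b = (0,2,5,7)` in `ℤ/11` (new). [folklore] -/
theorem per_four_ray_eleven_hit :
    ∃ k : ℕ, 0 < k ∧
      highestWeightSpace (orbitCoordRep (MvPolynomial.rename toLex (perPoly (Fin 4) ℂ)) 4)
        (partitionWeightLex 4 (Nat.Partition.rectangle 11 k)) ≠ ⊥ := by
  refine per_ray_hit_of_additive_design (m := 4) (j := 11) (by norm_num)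
    (![0, 1, 2, 3] : Fin 4 → Fin 11) (![0, 2, 5, 7] : Fin 4 → Fin 11)
    (!![(4/11 : ℚ), 4/11, 1/11, 2/11; 3/11, 2/11, 4/11, 2/11; 2/11, 4/11, 2/11, 3/11; 2/11, 1/11, 4/11, 4/11] : Matrix (Fin 4) (Fin 4) ℚ) ?_ ?_ ?_ ((4 : ℚ) / 11) (by norm_num) ?_
  · intro i i'
    fin_cases i <;> fin_cases i' <;> simp
  · intro i
    fin_cases i <;> simp [Fin.sum_univ_succ] <;> norm_num
  · intro i'
    fin_cases i' <;> simp [Fin.sum_univ_succ] <;> norm_num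
  · intro y
    fin_cases y <;> simp [Fin.sum_univ_succ] <;> norm_num

/-- **Ray 12 of `S(per_4)` is hit** — design `a = (0,1,2,3)`, `b = (0,2,6,8)` in `ℤ/12` (new). [folklore] -/
theorem per_four_ray_twelve_hit :
    ∃ k : ℕ, 0 < k ∧
      highestWeightSpace (orbitCoordRep (MvPolynomial.rename toLex (perPoly (Fin 4) ℂ)) 4)
        (partitionWeightLex 4 (Nat.Partition.rectangle 12 k)) ≠ ⊥ := by
  refine per_ray_hit_of_additive_design (m := 4) (j := 12) (by norm_num)
    (![0, 1, 2, 3] : Fin 4 → Fin 12) (![0, 2, 6, 8] : Fin 4 → Fin 12)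
    (!![(1/3 : ℚ), 1/3, 1/6, 1/6; 1/6, 1/6, 1/3, 1/3; 1/3, 1/3, 1/6, 1/6; 1/6, 1/6, 1/3, 1/3] : Matrix (Fin 4) (Fin 4) ℚ) ?_ ?_ ?_ ((4 : ℚ) / 12) (by norm_num) ?_
  · intro i i'
    fin_cases i <;> fin_cases i' <;> simp
  · intro i
    fin_cases i <;> simp [Fin.sum_univ_succ] <;> norm_num
  · intro i'
    fin_cases i' <;> simp [Fin.sum_univ_succ] <;> norm_num
  · intro y
    fin_cases y <;> simp [Fin.sum_univ_succ] <;> norm_num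

end Summit.ValiantsHypothesis.ValiantsHypothesis.Theorems.GeneratorObstructions.PerGenDegreeSuperQP

end
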